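import Summits.CriticalPhenomena.PercolationContinuityZ3.Theorems.Transplant.SkelFrmBParamsFaceFloorsPinSYA
import Summits.CriticalPhenomena.PercolationContinuityZ3.Theorems.Transplant.SkelFrmBParamsFaceFloorsLAdYA
import Summits.CriticalPhenomena.PercolationContinuityZ3.Theorems.Transplant.SkelFrmBParamsFaceOriginsYLA
import Summits.CriticalPhenomena.PercolationContinuityZ3.Theorems.Transplant.SkelFrmBParamsFaceOriginsXA
import Summits.CriticalPhenomena.PercolationContinuityZ3.Theorems.Transplant.SkelFrmBParamsFaceOriginsYA
import Summits.CriticalPhenomena.PercolationContinuityZ3.Theorems.Transplant.SkelFrmBParamsFramesF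
import Summits.CriticalPhenomena.PercolationContinuityZ3.Theorems.Transplant.SkelFrmBParamsFaceFloorsClrYF
import Summits.CriticalPhenomena.PercolationContinuityZ3.Theorems.Transplant.SkelFrmBParamsFaceFloorsClrYA
import Summits.CriticalPhenomena.PercolationContinuityZ3.Theorems.Transplant.SkelFrmBParamsFaceFloorsFAYA
import Summits.CriticalPhenomena.PercolationContinuityZ3.Theorems.Transplant.SkelFrmBParamsFaceFloorsFBYA
import Summits.CriticalPhenomena.PercolationContinuityZ3.Theorems.Transplant.SkelFrmBParamsFaceFloorsFTYA
import Summits.CriticalPhenomena.PercolationContinuityZ3.Theorems.Transplant.SkelFrmBParamsFaceFloorsLYA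
import Summits.CriticalPhenomena.PercolationContinuityZ3.Theorems.Transplant.SkelFrmBParamsFaceFloorsQYA
import Summits.CriticalPhenomena.PercolationContinuityZ3.Theorems.Transplant.SkelFrmBParamsFaceFloorsZPiYA
import Summits.CriticalPhenomena.PercolationContinuityZ3.Theorems.Transplant.SkelFrmBParamsFaceFloorsZYA
import Summits.CriticalPhenomena.PercolationContinuityZ3.Theorems.Transplant.SkelFrmBParamsFaceFloorsPinYA
import Summits.CriticalPhenomena.PercolationContinuityZ3.Theorems.Transplant.SkelFrmBParamsFaceCountsYA
import Summits.CriticalPhenomena.PercolationContinuityZ3.Theorems.Transplant.SkelFrmBParamsFaceCountsRangeYA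
import Summits.CriticalPhenomena.PercolationContinuityZ3.Theorems.Transplant.SkelFrmBParamsFaceCountsShiftYA
import Summits.CriticalPhenomena.PercolationContinuityZ3.Theorems.Transplant.SkelPhiFaceNumsYP2T
import Summits.CriticalPhenomena.PercolationContinuityZ3.Theorems.Transplant.SkelFrmBChoiceWindow
import Summits.CriticalPhenomena.PercolationContinuityZ3.Theorems.Transplant.PlanarSkeletonFrmDefs
import Summits.CriticalPhenomena.PercolationContinuityZ3.Theorems.Transplant.SkelPhiStepIDataNS
import Summits.CriticalPhenomena.PercolationContinuityZ3.Theorems.Transplant.SkelFrmBParamsFaceFloorsY2SA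
import Summits.CriticalPhenomena.PercolationContinuityZ3.Theorems.Transplant.SkelFrmBParamsFaceFloorsY2WA
import Summits.CriticalPhenomena.PercolationContinuityZ3.Theorems.Transplant.SkelFrmBParamsFaceFloorsYxB
import Summits.CriticalPhenomena.PercolationContinuityZ3.Theorems.Transplant.SkelFrmBParamsFaceFloorsClrXA
import HarnessLib
/-!
# N2 (frames-only node, OPEN) — (F) column, (R-49)(c2b) VALUE LAYER part C: **THE JUNCTION OF THE X4-SHAPED y′-FACE ROUTE** (hp-8 g43)

The second run (y′) starts at `yT := yL + crossOffX n_L h_L v_L σ σ N_x` (`KS.yTYx`); its floors are the origin-generic `floorsFA_YA` /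
`FA5_YA` / `FA6_YA` (PinSYA/FBYA) AT `yT`, which want: `|F1cA yT| ≤ 6u₁`, `|Λ₁(yT)| ≤ 3m`, and the junction's abscissa inside the room with margin
`9u₀ + 1`. This file derives them from the origin's facts (`|F1cA yL| ≤ 2u₁`, `|Λ₁(yL)| ≤ 2m`, `|FcA yL| ≤ 5u₀` — the x-face origin `yLXFs σ` has
them) by the EXACT level-neutrality of the prefix (`F1cA_crossOffX`, `F1cA_add_stride`, `Λ₁` is invariant under the strides `k·(n_L, h_L)`), the
one y′-step readings (`F1cA_yTX0_sub_abs_le`, `clr_abs_Λ₁of_yTX0_sub`, `FcA_yTX0_sub_abs_le`), `FcA_crossOffX` (`+ σ·u₀·(N_x+1)`), and the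
corrector's budget at the virtual junction (as `KS.tanYx_pos`): `KS.juncYx_F1cA`, `KS.juncYx_Λ₁`, `KS.juncYx_FcA`, `KS.juncYx_pos`.
NON-VACUITY: instantiated by part E at the node tuple. builds on p205010 (kernel theorem, internal audit signed; external expert review pending) —
nothing here uses p205010; NOTHING is claimed about the open node `SamePDropOfSkeletonFrm₁`.
Lane `prim-bschramm`, seat `prim-hp-8` (gen 43); helper file (`--supports stmt-CriticalPhenomena-4575 --as helper`).
[cite: KozmaNitzan2024, §4 Lemma 11–12 (pp. 21–25)] [cite: MartineauTassion2017, §4.3]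
-/

noncomputable section

open scoped Classical

namespace Summit.CriticalPhenomena.PercolationContinuityZ3.Theorems.Transplant

namespace PlanarSkeletonFrm

namespace NegB

open Literature.Probability.Percolation Literature.Probability.LatticeModels SimpleGraph KNCells KNLevels
open Literature.Probability.Percolation.KozmaNitzan.Cells (oth sgOf sgOf_sign stepVec_apply_fst)
open SkelConc (Consts)
open Skelφ (shearUnit shearUnit_pos yBoxLoS yBoxHiS ySLo ySHi yBnd xBoxB xSLo xSHi xBoxLoA xBoxHiA crossOffY yPrmW xCoreB xCSLo xCSHi)
open Skelφ.StepI (DataN)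
open ChainPlanar (BridgePrm)
open TwoAxis.Para (modulus)
open Neg

namespace KS

/-- `Λ₁` is invariant under the x-strides `k·(n_L, h_L)`. [folklore] -/
theorem Λ₁of_add_stride (κ : Consts) {V : Type} [DecidableEq V] [Countable V] {G : SimpleGraph V} [G.LocallyFinite] (Φ : PlanarSkeletonFrm G) (t : V) (p : unitInterval) (D : Skelφ.StepI.DataNS V) (g : ℕ) (f : ℕ) (y : Site 2) (k : ℤ) :
    Λ₁of κ Φ t p D g f (y + Skelφ.pt (k * nL κ Φ t p D g f) (k * hL κ Φ t p D g f)) = Λ₁of κ Φ t p D g f y := by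
  unfold Λ₁of; simp only [Pi.add_apply, Skelφ.pt_zero, Skelφ.pt_one]; ring

/-- **The junction's along reading**: `F1cA yT = F1cA (yTX0 yL σ)` (level-neutral prefix), hence `|F1cA yT| ≤ |F1cA yL| + 2`. [folklore] -/
theorem juncYx_F1cA (κ : Consts) {V : Type} [DecidableEq V] [Countable V] {G : SimpleGraph V} [G.LocallyFinite] (Φ : PlanarSkeletonFrm G) (t : V) (p : unitInterval) (D : Skelφ.StepI.DataNS V) (g : ℕ) (f : ℕ) (hN : EqNumL κ Φ t p D g f) (P : PCells2T) (yL x : Site 2) (du : MDir) (z : Site 2) (bw : ℕ) {C : ℤ} (he1 : |F1cA κ Φ t p D g f yL| ≤ C) :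
    F1cA κ Φ t p D g f (yTYx κ Φ t p D g f P yL x du z bw) = F1cA κ Φ t p D g f (yTX0 κ Φ t p D g f yL (sgOf du)) ∧ |F1cA κ Φ t p D g f (yTYx κ Φ t p D g f P yL x du z bw)| ≤ C + 2 := by
  have e : F1cA κ Φ t p D g f (yTYx κ Φ t p D g f P yL x du z bw) = F1cA κ Φ t p D g f (yTX0 κ Φ t p D g f yL (sgOf du)) := by unfold yTYx; exact F1cA_crossOffX κ Φ t p D g f yL (sgOf du) (sgOf du) _
  refine ⟨e, ?_⟩
  rw [e]
  have h := F1cA_yTX0_sub_abs_le κ Φ t p D g f hN yL (sgOf du)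
  have := abs_sub_abs_le_abs_sub (F1cA κ Φ t p D g f (yTX0 κ Φ t p D g f yL (sgOf du))) (F1cA κ Φ t p D g f yL)
  linarith

/-- **The junction's level**: `|Λ₁(yT)| ≤ |Λ₁(yL)| + n_L ≤ 2m + m`. [folklore] -/
theorem juncYx_Λ₁ (κ : Consts) {V : Type} [DecidableEq V] [Countable V] {G : SimpleGraph V} [G.LocallyFinite] (Φ : PlanarSkeletonFrm G) (t : V) (p : unitInterval) (D : Skelφ.StepI.DataNS V) (g : ℕ) (f : ℕ) (hN : EqNumL κ Φ t p D g f) (hℓ2 : 2 ≤ ℓL κ Φ t p D g f) (P : PCells2T) (yL x : Site 2) (du : MDir) (z : Site 2) (bw : ℕ)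
    (hΛ₁ : |Λ₁of κ Φ t p D g f yL| ≤ 2 * modulus (nL κ Φ t p D g f) (hL κ Φ t p D g f) (vL κ Φ t p D g f) (vβL κ Φ t p D g f)) :
    |Λ₁of κ Φ t p D g f (yTYx κ Φ t p D g f P yL x du z bw)| ≤ 3 * modulus (nL κ Φ t p D g f) (hL κ Φ t p D g f) (vL κ Φ t p D g f) (vβL κ Φ t p D g f) := by
  obtain ⟨hn1, hℓ1⟩ := one_le_of_eqNumL κ Φ t p D g f hN
  have e : Λ₁of κ Φ t p D g f (yTYx κ Φ t p D g f P yL x du z bw) = Λ₁of κ Φ t p D g f (yTX0 κ Φ t p D g f yL (sgOf du)) := by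
    unfold yTYx; rw [crossOffX_eq κ Φ t p D g f yL (sgOf du) (sgOf du)]; exact Λ₁of_add_stride κ Φ t p D g f _ _
  rw [e]
  have h1 := clr_abs_Λ₁of_yTX0_sub κ Φ t p D g f hN yL (sgOf du)
  have h2 := abs_sub_abs_le_abs_sub (Λ₁of κ Φ t p D g f (yTX0 κ Φ t p D g f yL (sgOf du))) (Λ₁of κ Φ t p D g f yL)
  obtain ⟨hm1, -⟩ := Skelφ.NegPrm.modulus_vβOf hn1 (hL κ Φ t p D g f) (ℓL κ Φ t p D g f) (vL κ Φ t p D g f)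
  have em : Skelφ.NegPrm.vβOf (nL κ Φ t p D g f) (hL κ Φ t p D g f) (ℓL κ Φ t p D g f) (vL κ Φ t p D g f) = vβL κ Φ t p D g f := rfl
  rw [em] at hm1
  have hℓ2' : (2 : ℤ) ≤ (ℓL κ Φ t p D g f : ℤ) := by exact_mod_cast hℓ2
  have hn0 : (0 : ℤ) ≤ (nL κ Φ t p D g f : ℤ) := by positivity
  nlinarith

/-- **The junction's abscissa reading**: `FcA yT = FcA (yTX0 yL σ) + σ·u₀·(N_x + 1)`, `|FcA (yTX0 yL σ) − FcA yL| ≤ u₀ + 2`. [folklore] -/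
theorem juncYx_FcA (κ : Consts) {V : Type} [DecidableEq V] [Countable V] {G : SimpleGraph V} [G.LocallyFinite] (Φ : PlanarSkeletonFrm G) (t : V) (p : unitInterval) (D : Skelφ.StepI.DataNS V) (g : ℕ) (f : ℕ) (hN : EqNumL κ Φ t p D g f) (P : PCells2T) (yL x : Site 2) (du : MDir) (z : Site 2) (bw : ℕ) :
    FcA κ Φ t p D g f (yTYx κ Φ t p D g f P yL x du z bw) = FcA κ Φ t p D g f (yTX0 κ Φ t p D g f yL (sgOf du)) + sgOf du * u₀A κ Φ t p D g f * ((NxW κ Φ t p D g f P yL x du z bw : ℤ) + 1) ∧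
      |FcA κ Φ t p D g f (yTX0 κ Φ t p D g f yL (sgOf du)) - FcA κ Φ t p D g f yL| ≤ u₀A κ Φ t p D g f + 2 :=
  ⟨by unfold yTYx; exact FcA_crossOffX κ Φ t p D g f hN yL (sgOf du) (sgOf du) _, FcA_yTX0_sub_abs_le κ Φ t p D g f hN yL (sgOf_sign du)⟩

/-- **The junction sits inside the transverse room with margin `9u₀ + 1`** (the `hlo/hhi` inputs of `FA5_YA/FA6_YA` at `yT`), one-sided:
from the corrector's budget at the prefix's start reading (the strides stop one past the window's near edge), the step
`|FcA (yTX0 yL σ) − FcA yL| ≤ u₀ + 2`, `|FcA yL| ≤ 5u₀`, `|T0Y| ≤ |z₀ − cen₀| + c₁` and the band row `2kE + 24u₀ + 24 + 2c₁ ≤ 5r₀`. [folklore] -/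
theorem juncYx_pos (κ : Consts) {V : Type} [DecidableEq V] [Countable V] {G : SimpleGraph V} [G.LocallyFinite] (Φ : PlanarSkeletonFrm G) (t : V) (p : unitInterval) (D : Skelφ.StepI.DataNS V) (g : ℕ) (f : ℕ) (hN : EqNumL κ Φ t p D g f) (P : PCells2T) (x : Site 2) (du : MDir) (hd : du.1 = 1) (hsg : sgOf du = 1) (z yL : Site 2) {kE : ℤ} (hz : |z 0 - P.cenS x 0| ≤ kE)
    (hkE24 : 2 * kE + 24 * u₀A κ Φ t p D g f + 24 + 2 * (P.c 1 : ℤ) ≤ 5 * (P.r 0 : ℤ)) (hu : 1 ≤ u₀A κ Φ t p D g f)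
    (he : |FcA κ Φ t p D g f yL| ≤ 5 * u₀A κ Φ t p D g f) (bw : ℕ) :
    -(5 * (P.r 0 : ℤ) - 4 - 3 - P.c 1 - |z 0 - P.cenS x 0|) + 9 * u₀A κ Φ t p D g f + 1 ≤ FcA κ Φ t p D g f (yTYx κ Φ t p D g f P yL x du z bw) ∧
      FcA κ Φ t p D g f (yTYx κ Φ t p D g f P yL x du z bw) + 9 * u₀A κ Φ t p D g f + 1 ≤ 5 * (P.r 0 : ℤ) - 4 - 3 - P.c 1 - |z 0 - P.cenS x 0| := by
  obtain ⟨eF, hdx⟩ := juncYx_FcA κ Φ t p D g f hN P yL x du z bw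
  have eσ : sgOf du * u₀A κ Φ t p D g f * ((NxW κ Φ t p D g f P yL x du z bw : ℤ) + 1) = u₀A κ Φ t p D g f * ((NxW κ Φ t p D g f P yL x du z bw : ℤ) + 1) := by
    rw [hsg, one_mul]
  rw [eF, eσ]
  set u := u₀A κ Φ t p D g f with hu_def
  set yTv := yTX0 κ Φ t p D g f yL (sgOf du) with hyTv
  have hun : ((u.toNat : ℕ) : ℤ) = u := Int.toNat_of_nonneg (by linarith)
  have hu0 : 0 < u.toNat := by omega
  have up := Skelφ.mul_fwdCount_lt (T := T0Y P x du z) (F := FcA κ Φ t p D g f yTv + u) (bw := bw) hu0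
  rw [hun] at up
  have hN : (N3WY κ Φ t p D g f P yTv x du z bw : ℤ) = (Skelφ.fwdCount (T0Y P x du z) (FcA κ Φ t p D g f yTv + u) u.toNat bw : ℤ) := rfl
  have hc0 : (0 : ℤ) ≤ P.c 1 := P.c_nonneg 1
  have hσ1 : |sgOf du| = 1 := by rw [hsg]; norm_num
  have hTle' : |T0Y P x du z| ≤ |z 0 - P.cenS x 0| + P.c 1 := by
    have e : T0Y P x du z = -(z 0 - P.cenS x 0) + sgOf du * P.c 1 := by unfold T0Y; rw [cenS_step_zero P x du hd]; ring
    rw [e]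
    calc |-(z 0 - P.cenS x 0) + sgOf du * P.c 1| ≤ |-(z 0 - P.cenS x 0)| + |sgOf du * P.c 1| := abs_add_le _ _
      _ = |z 0 - P.cenS x 0| + P.c 1 := by rw [abs_neg, abs_mul, hσ1, one_mul, abs_of_nonneg hc0]
  have ha0 : 0 ≤ |z 0 - P.cenS x 0| := abs_nonneg _
  obtain ⟨e1, e2⟩ := abs_le.1 he
  obtain ⟨x1, x2⟩ := abs_le.1 hdx
  obtain ⟨t1, t2⟩ := abs_le.1 hTle'
  have hbw0 : (0 : ℤ) ≤ bw := Nat.cast_nonneg _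
  -- `N_x = max 6 N`: either the forced strides or the corrector's strides
  have hNx : (NxW κ Φ t p D g f P yL x du z bw : ℤ) ≤ 6 ∨ (NxW κ Φ t p D g f P yL x du z bw : ℤ) ≤ (N3WY κ Φ t p D g f P yTv x du z bw : ℤ) := by
    unfold NxW NX0
    rcases le_total 6 (N3WY κ Φ t p D g f P yTv x du z bw) with h | h
    · right; rw [max_eq_right h]
    · left; rw [max_eq_left h]; norm_num
  have hNx0 : (0 : ℤ) ≤ (NxW κ Φ t p D g f P yL x du z bw : ℤ) := by positivity
  have hk0 : (0 : ℤ) ≤ u * ((NxW κ Φ t p D g f P yL x du z bw : ℤ) + 1) := mul_nonneg (by linarith) (by linarith)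
  rcases hNx with h5 | hkN
  · have hk5' : u * ((NxW κ Φ t p D g f P yL x du z bw : ℤ) + 1) ≤ u * 7 := mul_le_mul_of_nonneg_left (by linarith) (by linarith)
    constructor <;> linarith
  · rw [hN] at hkN
    generalize (Skelφ.fwdCount (T0Y P x du z) (FcA κ Φ t p D g f yTv + u) u.toNat bw : ℤ) = N at up hkN
    have hku : u * ((NxW κ Φ t p D g f P yL x du z bw : ℤ) + 1) ≤ u * N + u := by nlinarith
    rcases le_max_iff.1 up with h | h
    · constructor <;> linarith
    · constructor <;> linarith

end KS

end NegB

end PlanarSkeletonFrm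

end Summit.CriticalPhenomena.PercolationContinuityZ3.Theorems.Transplant

end
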